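import Summits.QuantumFields.YangMills.Theorems.BalabanUVNodesN07NearRowsAtRecordWide
import HarnessLib

/-!
# N07 [B11] (= [15] = [Balaban1985Variational]) Sect. F — **THE ONE-BLOCK DENT ROWS AT THE RECORD**: MODULE 72's two-block data letter and MODULE 75's within-block dent row re-stated for a
# SINGLE dent block `t` (no neighbouring dent label needed) — the within-block cells of an ISOLATED dent block of print's `□′_k^{(k−1)}` get their δ-type near row

Cell `pub-ymgap`, seat `pub-ymgap-dag-n07-e` g26 (FAN-OUT §N07 row s3; LANE OWNER of the K0 road), MODULE 81 (INTENT-81, cell bus).  `--kind proof --supports stmt-QuantumFields-20541 --as helper`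
(K0⁷); count-neutral; def-free.  [15] = [Balaban1985Variational]; [III] = [Balaban1988Convergent]; [6] = [Balaban1985RegularSpaces].

WHY.  MODULE 75's within-block dent row `norm_mlog_shearedAvgIter_dentPair_within_le_of_data` (p690106) is keyed on a dent PAIR `t, t + e_μ` (both labels off `Γ_j`, both in the chart box)
because it draws its plaquette letter from MODULE 72's two-block lemma `plaqSmallOn_dentPair_iter_of_data`; but its proof uses only the ONE-block box of `t` (`hA'`), and a dent block of
print's `□′_k^{(k−1)} = □_k ∖ Ω_k` ((147) p. 301) may be ISOLATED (every face-neighbour in `Ω_k` or outside `□_k`): for the bonds inside such a block no pair exists.  The near class of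
HCHART-MEET-NORM-77 contains those bonds (both end blocks — the same block — in `□_k`), so the chart needs the row with the single key `t`.  THIS FILE: §1 the one-block data letter (72's
record proof on the degenerate label interval `[t, t]`: margin∕collar∕support per label as in 69b, the corner dichotomy's second branch at `t`, 72 §1 `plaqSmallOn_blowDown_iter_of_below`);
§2 the within-block row at the record (75's proof with §1 for 72): `‖log 𝒜_m(U^u)(b)‖ ≤ 2·τ_rad(δ_m)` for every level-`m` cell `b` of `D″` with both end blocks `B(castSite t)`.

WHAT IS PROVED (sorry-free; no definition; axioms standard).  §1 ★★ `plaqSmallOn_dentBlock_iter_of_data` — 72's conclusion on the one-block box `boxPlaqs (L·t) (L·t + (L−1))` from `ht`,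
`hdent` alone.  §2 ★★★ `norm_mlog_shearedAvgIter_dentBlock_within_le_of_data` — 75's within row with the keys `t`, `ht`, `hdent` only (no `μ`, `htμ`, `hdentμ`).
HONEST SCOPE.  By-name compositions of landed modules (69b ∕ 71″ ∕ 72 ∕ 75 machinery); the data (`DataSmall7PTop`), the fibre, the run's separation∕grid∕floor, the meeting and margin-clean
premises, `NrmOfRecordWide` and the (2.2) collar are HYPOTHESES as in 75; nothing of [15]∕[6]∕[III] ANALYSIS asserted beyond the cited landed lemmas; K0⁷ ∕ K1⁹ NOT closed; N07 NOT
discharged; counts unmoved (typed 28∕28 · discharged 8∕27 per the chair); one finite 𝕋⁴ programme at fixed ε — the route closes the conditional finite-𝕋⁴ rung `BalabanLadder.UV` ONLY; the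
YM mass gap (Clay) is NOT proved by any of this; nothing continuum ∕ ℝ⁴ ∕ OS.  No `sorry`, no `def`, no `instance`, no `notation`.

References: [15] (7) p. 278, (144) p. 300, (147)–(150) p. 301, (160) p. 303; [6] Lemma 1 (1.25) p. 79, p. 98; [III] (2.2) p. 255, (2.10)–(2.13) pp. 255–257.
-/

set_option autoImplicit false

noncomputable section

open scoped BigOperators Matrix.Norms.L2Operator

namespace Summit.QuantumFields.YangMills.BalabanUVNodes.N07DentBlockDataSmall

open Literature.MathematicalPhysics.QuantumFieldTheory.Balaban1983to89
open Literature.MathematicalPhysics.QuantumFieldTheory.Balaban1983to89.Node00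
open Literature.MathematicalPhysics.QuantumFieldTheory.Balaban1983to89.B15DeterminingSets
open T4Continuum (T4Family)
open T4AxialGaugeSmallField (castSite castSite_apply boxBonds boxPlaqs)
open B15Eq112TorusCover (cover)
open B14DomainGeom (Pt Within)
open B7Prop1Explicit (e e_apply)
open B8Eq131Cubes (box bLo bHi sqLo sqHi tLo tHi crad)
open B5Eq118OneStroke (iterBlockOf)
open GaugeField (plaqHol gaugeAct)
open ExpMeanLog (expMeanLogSU deltaSU)
open MatrixLog (mlog)
open Summit.QuantumFields.Balaban3D.Carriers (radialContourData)
open Summit.QuantumFields.YangMills.Theorems.FlatCubeOpsText (Adm22)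
open Summit.QuantumFields.YangMills.BalabanUVNodes.N07DentPairDataSmall (plaqSmallOn_blowDown_iter_of_below)
open Summit.QuantumFields.YangMills.BalabanUVNodes.N07ChartTopBoxPlaquetteValues (corner_dichotomy)
open Summit.QuantumFields.YangMills.BalabanUVNodes.N07ChartTopBoxDataSmall (unitBox_subset_chartBox exists_mem_box_within_of_mem_chartBox two_mul_L_lt_sitesPerDir)
open Summit.QuantumFields.YangMills.BalabanUVNodes.N07SplitClauseLevelRaisingMarginWide (chartTopBox_subset_wboxPrint)
open Summit.QuantumFields.YangMills.BalabanUVNodes.N07RecordDomainsAdm22 (blockSat_seqOfRecord)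
open Summit.QuantumFields.YangMills.BalabanUVNodes.N07NormalisationOfRecordWide (NrmOfRecordWide)
open Summit.QuantumFields.YangMills.BalabanUVNodes.N07DentRowsWide (NrmOfRecordWide.norm_mlog_shearedAvgIter_dent_within_le)

variable (F : T4Family) (N : ℕ) [NeZero N]

/-! ## §1  The one-block data letter: plaquettes of `M^m U` based in one dent block are printed (7) plaquettes of level `m` -/

/-- ★★ **THE PLAQUETTES OF `M^m U` BASED IN ONE DENT BLOCK ARE `< δ_m`** — MODULE 72's `plaqSmallOn_dentPair_iter_of_data` for a SINGLE chart-box label `t` off `Γ_{m+1}` (an isolated dent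
block of print's `□′_k^{(k−1)}`): at a meeting, print-margin-clean datum `(m+1, idx)` of a separated run with the grid numerics and the floor `(11d + 4ρ + Mc)·L + 3 ≤ M₁`, every level-`m`
plaquette based in `B(castSite t)` is a printed (7) plaquette of level `m`, hence `< δ_m` by the data (72's record proof on the label interval `[t, t]`).
[cite: Balaban1985Variational, (7) p.278, (147) p.301, (160) p.303; Balaban1988Convergent, (2.2), (2.10)–(2.13) pp.255–257; Balaban1985RegularSpaces, p.98] -/
theorem plaqSmallOn_dentBlock_iter_of_data {ν : Stage7Numerics} {M : ℕ} {g : ℕ → ℝ} {K k : ℕ} (s : SeqOfRecord F ν M g K k)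
    (hsep : Sect2.SeqSeparated ν.M₁ s) (hkK : k ≤ (F.P K).m + (F.P K).K)
    (hgrid : ∀ j : ℕ, 1 ≤ j → j ≤ k → dCubeSide (F.P K).L M (RkOfRecord (F.P K).L ν.r (g j)) j ∣ (F.P K).sitesPerDir 0)
    {Mc ρ : ℕ} (hMc : 1 ≤ Mc) (hρ : 1 ≤ ρ) (hfloor : (11 * (F.P K).d + 4 * ρ + Mc) * (F.P K).L + 3 ≤ ν.M₁)
    {δ : ℕ → ℝ} (W : MSField (F.P K) (SU N)) (h7 : Sect2.DataSmall7PTop (avOfRecord F N K) s.Ω (suppDomOfRecord F ν K s.Ω) k δ W)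
    (U : GaugeField (F.P K) 0 (SU N)) (hfib : AgreeOn (genSet s.Ω k) (avgFamily (avOfRecord F N K) U) W)
    {m : ℕ} (hjk : m + 1 ≤ k) (hjK : m + 1 ≤ (F.P K).m + (F.P K).K) (idx : Pt (F.P K).d)
    (hmeet : ∃ x ∈ box (F.P K).L (cornerP (F.P K) Mc ρ idx) (sideP (F.P K) Mc ρ) (m + 1), ∃ y : Pt (F.P K).d, cover (F.P K) y ∈ s.Ω (m + 1) ∧ Within ((3 : ℕ) : ℤ) x y)
    (hclean : m + 1 = k ∨ ∀ z ∈ box (F.P K).L (cornerP (F.P K) Mc ρ idx - ((2 * ρ : ℕ) : Pt (F.P K).d)) (sideP (F.P K) Mc ρ + 2 * (2 * ρ)) (m + 1),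
      cover (F.P K) z ∉ s.Ω (m + 1 + 1))
    (t : Pt (F.P K).d)
    (ht : t ∈ Set.Icc (sqLo (F.P K).L (cornerP (F.P K) Mc ρ idx) ρ (m + 1) (m + 1) - 1) (sqHi (F.P K).L (cornerP (F.P K) Mc ρ idx) (sideP (F.P K) Mc ρ) ρ (m + 1) (m + 1) + 1))
    (hdent : (castSite t : Site (F.P K) (m + 1)) ∉ genSet s.Ω k (m + 1)) :
    PlaqSmallOn (boxPlaqs (fun i => ((F.P K).L : ℤ) * t i) (fun i => ((F.P K).L : ℤ) * t i + (((F.P K).L : ℤ) - 1))) (δ m)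
      (Averaging.iter (avOfRecord F N K) m U) := by
  set c : Pt (F.P K).d := cornerP (F.P K) Mc ρ idx with hc
  set S : ℕ := sideP (F.P K) Mc ρ with hS
  have hν0 : 0 < ν.M₁ := by omega
  have hν1 : 1 ≤ ν.M₁ := hν0
  have hρ0 : 0 < ρ := hρ
  have hS1 : 1 ≤ S := by have := le_sideP (P := F.P K) Mc hρ0; omega
  -- block saturation of `Ω_{m+1}`
  have hsat : ∀ x x' : Site (F.P K) 0, iterBlockOf (m + 1) x = iterBlockOf (m + 1) x' → x ∈ s.Ω (m + 1) → x' ∈ s.Ω (m + 1) :=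
    fun x x' => blockSat_seqOfRecord F ν M g K k hkK s hgrid (m + 1) x x' (by omega) hjk
  -- the data's clauses at level `m`
  have h7m : 1 ≤ m → ∀ q : Plaq (F.P K) m, q ∈ Sect2.printedPlaqs s.Ω k m → (∀ c' : PBond (F.P K) m,
      (c' = ⟨q.src, q.μ⟩ ∨ c' = ⟨q.src.shift q.μ, q.ν⟩ ∨ c' = ⟨q.src.shift q.ν, q.μ⟩ ∨ c' = ⟨q.src, q.ν⟩) → c' ∈ bondsOf (genSet s.Ω k m)) → dist1 (plaqHol (W m) q) < δ m := by
    intro h1 q hq hb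
    obtain ⟨m', rfl⟩ : ∃ m', m = m' + 1 := ⟨m - 1, by omega⟩
    have h7' := h7.2 m' (by omega) q hq
    have heq : plaqHol (Sect2.mixedField (avOfRecord F N K) (genSet s.Ω k (m' + 1)) (W (m' + 1)) (W m')) q = plaqHol (W (m' + 1)) q := by
      unfold GaugeField.plaqHol
      rw [Sect2.mixedField_of_mem _ _ _ (hb _ (Or.inl rfl)), Sect2.mixedField_of_mem _ _ _ (hb _ (Or.inr (Or.inl rfl))),
        Sect2.mixedField_of_mem _ _ _ (hb _ (Or.inr (Or.inr (Or.inl rfl)))), Sect2.mixedField_of_mem _ _ _ (hb _ (Or.inr (Or.inr (Or.inr rfl))))]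
    rwa [heq] at h7'
  have h70 : m = 0 → PlaqSmallOn (Sect2.printedPlaqsTop s.Ω (suppDomOfRecord F ν K s.Ω) k) (δ m) (W 0) := by
    intro h0; subst h0; exact h7.1
  -- (i) margin, (ii) collar — for every label of the chart box (as MODULE 69b ∕ 72)
  have hfar : ∀ t' ∈ Set.Icc (sqLo (F.P K).L c ρ (m + 1) (m + 1) - 1) (sqHi (F.P K).L c S ρ (m + 1) (m + 1) + 1),
      ∀ z ∈ box (F.P K).L t' 1 (m + 1), cover (F.P K) z ∉ s.Ω (m + 2) := by
    intro t' ht' z hz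
    rcases hclean with htop | hcl
    · rw [s.Ω_off (m + 2) (by omega)]; exact Set.notMem_empty _
    · exact hcl z (chartTopBox_subset_wboxPrint (F.P K).L c S (m + 1) hρ (unitBox_subset_chartBox c S ρ (m + 1) ht' hz))
  obtain ⟨x₀, hx₀, y₀, hy₀, hxy₀⟩ := hmeet
  have hcol : 1 ≤ m → ∀ t' ∈ Set.Icc (sqLo (F.P K).L c ρ (m + 1) (m + 1) - 1) (sqHi (F.P K).L c S ρ (m + 1) (m + 1) + 1),
      ∀ z ∈ box (F.P K).L t' 1 (m + 1), cover (F.P K) z ∈ s.Ω m := by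
    intro h1 t' ht' z hz
    obtain ⟨y', hy', hzy'⟩ := exists_mem_box_within_of_mem_chartBox c hS1 hρ (m + 1) ht' hz
    have hfl : 11 * (F.P K).d + 2 * ρ + Mc + 3 + 2 * ρ ≤ ν.M₁ := by
      have hL1 : 1 ≤ (F.P K).L := (F.P K).L_pos
      have : 11 * (F.P K).d + 4 * ρ + Mc ≤ (11 * (F.P K).d + 4 * ρ + Mc) * (F.P K).L := Nat.le_mul_of_pos_right _ hL1
      omega
    have h := Sect2.cover_mem_Ω_pred_of_near_box_propCubeP_box (P := F.P K) hν1 s hsep (Dw := 3) (E := 2 * ρ) hfl (n := m + 1) (by omega) hjk hx₀ hy₀ hxy₀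
      (z := z) (y' := y') hy' (by simpa [mul_comm, mul_assoc] using hzy')
    simpa using h
  -- (iii) support at `m = 0`, for the single label `t`
  have hsupp : m = 0 → ∀ t' ∈ Set.Icc t t, ∀ z ∈ box (F.P K).L t' 1 (m + 1), cover (F.P K) z ∈ suppDomOfRecord F ν K s.Ω := by
    intro h0 t' ht' z hz
    subst h0
    have ht't : t' = t := le_antisymm (fun i => ht'.2 i) (fun i => ht'.1 i)
    subst ht't
    obtain ⟨y', hy', hzy'⟩ := exists_mem_box_within_of_mem_chartBox c hS1 hρ (0 + 1) ht hz
    have hbox := within_of_mem_box_of_mem_box (F.P K).L hy' hx₀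
    have hw := (hzy'.triangle hbox).triangle hxy₀
    rw [suppDomOfRecord_eq]
    refine cover_mem_hullD_one_of_within hν0 hy₀ (hw.mono ?_)
    have hSle : (S : ℤ) ≤ Mc + 11 * (F.P K).d + 2 * ρ := by exact_mod_cast sideP_le (P := F.P K) Mc ρ
    have hf : (((11 * (F.P K).d + 4 * ρ + Mc) * (F.P K).L + 3 : ℕ) : ℤ) ≤ ν.M₁ := by exact_mod_cast hfloor
    push_cast at hf ⊢
    have hL0 : (0 : ℤ) ≤ (F.P K).L := by positivity
    nlinarith
  -- the dichotomy's SECOND branch at `t` (it is OFF `Γ_{m+1}`)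
  have hgood2 : ∀ t' ∈ Set.Icc t t, ∀ y' : Site (F.P K) m, blockOf y' = (castSite t' : Site (F.P K) (m + 1)) → y' ∈ genSet s.Ω k m := by
    intro t' ht' y' hy'
    have ht't : t' = t := le_antisymm (fun i => ht'.2 i) (fun i => ht'.1 i)
    subst ht't
    have hd := corner_dichotomy s.Ω hjk hjK hsat (hfar t' ht) (fun h1 => hcol h1 t' ht)
    rcases hd with h | h
    · exact absurd h hdent
    · exact h y' hy'
  exact plaqSmallOn_blowDown_iter_of_below F N K s.Ω W U hjk hjK hfib h7m h70 hgood2 hsupp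

/-! ## §2  The within-block dent row at the record, one-block key -/

/-- ★★★ **THE WITHIN-BLOCK DENT ROW AT THE RECORD, ONE-BLOCK KEY** — MODULE 75's `norm_mlog_shearedAvgIter_dentPair_within_le_of_data` with the keys `t`, `ht`, `hdent` only: at a
meeting, print-margin-clean datum `(m+1, idx)` of a separated run, under `NrmOfRecordWide … u A` and the (2.2) collar of `D″`, with the log-range guard on `a₁`: for a chart-box label `t`
OFF `Γ_{m+1}` and every level-`m` constraint bond `b` of `D″` with both end blocks `B(castSite t)`, `‖log 𝒜_m(U^u)(b)‖ ≤ 2·(d(L−1)+1)·(d−1)(L−1)·δ_m` (71″ within ∘ §1).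
[cite: Balaban1985Variational, (160) p.303 (second case), (147) p.301, (7) p.278; Balaban1985RegularSpaces, Lemma 1 (1.25) p.79, p.98; Balaban1988Convergent, (2.10)–(2.13) pp.255–257] -/
theorem norm_mlog_shearedAvgIter_dentBlock_within_le_of_data {ν : Stage7Numerics} {M : ℕ} {g : ℕ → ℝ} {K k : ℕ} (s : SeqOfRecord F ν M g K k)
    (hsep : Sect2.SeqSeparated ν.M₁ s) (hkK : k ≤ (F.P K).m + (F.P K).K)
    (hgrid : ∀ j : ℕ, 1 ≤ j → j ≤ k → dCubeSide (F.P K).L M (RkOfRecord (F.P K).L ν.r (g j)) j ∣ (F.P K).sitesPerDir 0)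
    {Mc ρ : ℕ} (hMc : 1 ≤ Mc) (hρ : 1 ≤ ρ) (hfloor : (11 * (F.P K).d + 4 * ρ + Mc) * (F.P K).L + 3 ≤ ν.M₁)
    {δ : ℕ → ℝ} {a₁ : ℝ} (hδ : ∀ n, n ≤ k → 0 < δ n ∧ δ n ≤ a₁)
    (hlog : (((F.P K).d * ((F.P K).L - 1) + 1 : ℕ) : ℝ) * (((((F.P K).d - 1 : ℕ) : ℝ) * (((F.P K).L - 1 : ℕ) : ℝ)) * a₁) ≤ 1 / 2)
    (W : MSField (F.P K) (SU N)) (h7 : Sect2.DataSmall7PTop (avOfRecord F N K) s.Ω (suppDomOfRecord F ν K s.Ω) k δ W)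
    (U : GaugeField (F.P K) 0 (SU N)) (hfib : AgreeOn (genSet s.Ω k) (avgFamily (avOfRecord F N K) U) W)
    {m : ℕ} (hjk : m + 1 ≤ k) (hjK : m + 1 + 1 ≤ (F.P K).m + (F.P K).K) (idx : Pt (F.P K).d)
    (hmeet : ∃ x ∈ box (F.P K).L (cornerP (F.P K) Mc ρ idx) (sideP (F.P K) Mc ρ) (m + 1), ∃ y : Pt (F.P K).d, cover (F.P K) y ∈ s.Ω (m + 1) ∧ Within ((3 : ℕ) : ℤ) x y)
    (hclean : m + 1 = k ∨ ∀ z ∈ box (F.P K).L (cornerP (F.P K) Mc ρ idx - ((2 * ρ : ℕ) : Pt (F.P K).d)) (sideP (F.P K) Mc ρ + 2 * (2 * ρ)) (m + 1),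
      cover (F.P K) z ∉ s.Ω (m + 1 + 1))
    (t : Pt (F.P K).d)
    (ht : t ∈ Set.Icc (sqLo (F.P K).L (cornerP (F.P K) Mc ρ idx) ρ (m + 1) (m + 1) - 1) (sqHi (F.P K).L (cornerP (F.P K) Mc ρ idx) (sideP (F.P K) Mc ρ) ρ (m + 1) (m + 1) + 1))
    (hdent : (castSite t : Site (F.P K) (m + 1)) ∉ genSet s.Ω k (m + 1))
    {u : GaugeTransf (F.P K) 0 (SU N)} {A : PBond (F.P K) 0 → MatA N} (hk : m + 1 ≤ (F.P K).m + (F.P K).K)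
    (hN : NrmOfRecordWide F N Mc ρ ν M g K k s U (m + 1) idx u A) {R Mb : ℕ}
    (hAdm : Adm22 (domainsMeet (cubeDomains (F.P K) (cornerP (F.P K) Mc ρ idx) (sideP (F.P K) Mc ρ) ρ (m + 1) hk) (domainsOfSeq s.Ω (m + 1) hk)) R Mb)
    (hRM : 2 * (F.P K).L ≤ R * Mb + 1)
    (b : PBond (F.P K) m)
    (hb : (domainsMeet (cubeDomains (F.P K) (cornerP (F.P K) Mc ρ idx) (sideP (F.P K) Mc ρ) ρ (m + 1) hk) (domainsOfSeq s.Ω (m + 1) hk)).LamBond m b)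
    (hsrc : blockOf b.src = (castSite t : Site (F.P K) (m + 1))) (htgt : blockOf b.tgt = (castSite t : Site (F.P K) (m + 1))) :
    ‖mlog ((shearedAvgIter (avOfRecord F N K) (fun i => radialContourData (F.P K) i (SU N)) (loopAvgBlockOp expMeanLogSU) (gaugeAct u U) m b : SU N) : MatA N)‖ ≤
      2 * ((((F.P K).d * ((F.P K).L - 1) + 1 : ℕ) : ℝ) * (((((F.P K).d - 1 : ℕ) : ℝ) * (((F.P K).L - 1 : ℕ) : ℝ)) * δ m)) := by
  have hA' := plaqSmallOn_dentBlock_iter_of_data F N s hsep hkK hgrid hMc hρ hfloor W h7 U hfib hjk (by omega) idx hmeet hclean t ht hdent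
  have hδm : 0 < δ m := (hδ m (by omega)).1
  have hδm1 : δ m ≤ a₁ := (hδ m (by omega)).2
  have hNm : (F.P K).L < (F.P K).sitesPerDir m := by have := two_mul_L_lt_sitesPerDir (P := F.P K) (m := m) (by omega); omega
  have hTc0 : (0 : ℝ) ≤ ((((F.P K).d - 1 : ℕ) : ℝ) * (((F.P K).L - 1 : ℕ) : ℝ)) := by positivity
  have hTb0 : (0 : ℝ) ≤ (((F.P K).d * ((F.P K).L - 1) + 1 : ℕ) : ℝ) := by positivity
  have hr : (((F.P K).d * ((F.P K).L - 1) + 1 : ℕ) : ℝ) * (((((F.P K).d - 1 : ℕ) : ℝ) * (((F.P K).L - 1 : ℕ) : ℝ)) * δ m) ≤ 1 / 2 :=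
    le_trans (mul_le_mul_of_nonneg_left (mul_le_mul_of_nonneg_left hδm1 hTc0) hTb0) hlog
  exact NrmOfRecordWide.norm_mlog_shearedAvgIter_dent_within_le F N hN hk hAdm hRM t hδm.le hNm hA' hr b hb hsrc htgt

end Summit.QuantumFields.YangMills.BalabanUVNodes.N07DentBlockDataSmall

end
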